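import Summits.CriticalPhenomena.PercolationContinuityZ3.Theorems.Transplant.SkelPhiParaRunSteps
import HarnessLib

/-!
# N1 (the `{±1}` node), LEVEL 1, kit adapter file 1a: WEAK UNIT STEPS OF A WINDOW MAP — `Skelφ.PsiSteps G ψ L₀`: every vertex has, in every
# planar direction, a vertex ONE ψ-unit away joined to it by a walk of length `≤ L₀` whose ψ-track stays in the hull box of the two endpoints
# widened by one.  D″'s (ι) `Steps G φ` is the case `ψ = φ`, `L₀ = 1`; the N1 run frames have weak steps with `L₀ = 2(|h|/n + 2)` (file 1b
# `SkelPhiPsiStepsRun`).  Iterating, every ψ-target is reached within graph distance `L₀·‖Δψ‖₁` with the track in the hull box `± 1` — the device that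
# lets the deep-slab KIT LAYER be re-typed ONCE over `(ψ, PsiSteps)` instead of `(φ, Steps)` (two-map siting, hp-8 NEG-NODE-F-SCOPE §10.5/§12 (s1)(s5);
# p1 plan, lane INBOX 2026-08-21 ≈13:11Z)

builds on p205010 (kernel theorem, internal audit signed; external expert review pending) — nothing in this file uses p205010; nothing here is a
claim about the open node `SamePDropOfSkeletonNeg`.
Lane `prim-bschramm`, seat `prim-bschramm-p1` (gen 11; kit adapter part 2 = p1 per p3-g8 13:01Z / lead 13:06Z); helper file (`--supports stmt-CriticalPhenomena-4575 --as helper`).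
* §1 `InHull a b y` (the hull box `± 1`), **`PsiSteps G ψ L₀`**, `PsiSteps.mono`, **`psiSteps_of_steps`** (`Steps G φ ⇒ PsiSteps G φ 1`);
* §2 iteration: **`PsiSteps.exists_walk_eq`** (reach any planar target `y`: a vertex `w′` with `ψ w′ = y`, a walk of length `≤ L₀·‖y − ψ w‖₁`, track in the hull of
  `ψ w`, `y` widened by one), `PsiSteps.exists_mem_graphBall_eq`.
[cite: KozmaNitzan2024, Lemma 10 Step III (p. 19: the path into the cube)] [cite: MartineauTassion2017, §4.3]
-/

noncomputable section

namespace Summit.CriticalPhenomena.PercolationContinuityZ3.Theorems.Transplant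

namespace Skelφ

open Literature.Probability.Percolation Literature.Probability.LatticeModels SimpleGraph
open Literature.Barriers.CriticalPhenomena (graphBall graphBall_mono mem_graphBall_self)

variable {V : Type} {G : SimpleGraph V}

/-! ## §1 Weak unit steps -/

/-- `u`'s planar position lies in the hull box of `a`, `b` widened by one. [this work] -/
def InHull (a b y : Site 2) : Prop := ∀ j : Fin 2, min (a j) (b j) - 1 ≤ y j ∧ y j ≤ max (a j) (b j) + 1

/-- **Weak unit steps of a window map**: in every planar direction a vertex one ψ-unit away, joined by a walk of length `≤ L₀` whose ψ-track stays in
the hull box of the endpoints widened by one. [this work] -/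
def PsiSteps (G : SimpleGraph V) (ψ : V → Site 2) (L₀ : ℕ) : Prop :=
  ∀ (w : V) (i : Fin 2) (σ : ℤˣ), ∃ w' : V, ψ w' = ψ w + Pi.single i (σ : ℤ) ∧
    ∃ p : G.Walk w w', p.length ≤ L₀ ∧ ∀ u ∈ p.support, InHull (ψ w) (ψ w') (ψ u)

/-- The endpoints lie in the widened hull. [folklore] -/
theorem inHull_left (a b : Site 2) : InHull a b a := fun j => ⟨by have := min_le_left (a j) (b j); omega, by have := le_max_left (a j) (b j); omega⟩

/-- The endpoints lie in the widened hull. [folklore] -/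
theorem inHull_right (a b : Site 2) : InHull a b b := fun j => ⟨by have := min_le_right (a j) (b j); omega, by have := le_max_right (a j) (b j); omega⟩

/-- Hulls are monotone: if `a'`, `b'` lie in the (unwidened) hull box of `a`, `b`, then `InHull a' b' ⊆ InHull a b`. [folklore] -/
theorem InHull.mono {a b a' b' y : Site 2} (ha : ∀ j, min (a j) (b j) ≤ a' j ∧ a' j ≤ max (a j) (b j))
    (hb : ∀ j, min (a j) (b j) ≤ b' j ∧ b' j ≤ max (a j) (b j)) (h : InHull a' b' y) : InHull a b y := fun j => by
  obtain ⟨h1, h2⟩ := h j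
  obtain ⟨ha1, ha2⟩ := ha j
  obtain ⟨hb1, hb2⟩ := hb j
  constructor
  · have hmin : min (a j) (b j) ≤ min (a' j) (b' j) := le_min ha1 hb1; omega
  · have hmax : max (a' j) (b' j) ≤ max (a j) (b j) := max_le ha2 hb2; omega

/-- Weak steps with a larger length bound. [folklore] -/
theorem PsiSteps.mono {ψ : V → Site 2} {L₀ L₁ : ℕ} (h : PsiSteps G ψ L₀) (hL : L₀ ≤ L₁) : PsiSteps G ψ L₁ := fun w i σ => by
  obtain ⟨w', hw', p, hp, htrack⟩ := h w i σ
  exact ⟨w', hw', p, hp.trans hL, htrack⟩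

/-- **(ι) unit steps are weak unit steps with `L₀ = 1`.** [folklore] -/
theorem psiSteps_of_steps {φ : V → Site 2} (hstep : Steps G φ) : PsiSteps G φ 1 := fun w i σ => by
  obtain ⟨w', hadj, hφ⟩ := hstep w i σ
  refine ⟨w', hφ, SimpleGraph.Walk.cons hadj SimpleGraph.Walk.nil, by simp, fun u hu => ?_⟩
  rw [SimpleGraph.Walk.support_cons, SimpleGraph.Walk.support_nil, List.mem_cons, List.mem_singleton] at hu
  rcases hu with rfl | rfl
  · exact inHull_left _ _
  · exact inHull_right _ _

/-! ## §2 Iteration: reaching any planar target -/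

/-- The ℓ¹ distance of two planar points, as a natural number. [folklore] -/
def l1 (a b : Site 2) : ℕ := (a 0 - b 0).natAbs + (a 1 - b 1).natAbs

/-- **Reaching a planar target by weak steps**: a vertex `w′` with `ψ w′ = y`, a walk from `w` of length `≤ L₀ · ‖y − ψ w‖₁` whose ψ-track stays in the hull of
`ψ w` and `y` widened by one. [cite: KozmaNitzan2024, §4 p. 26 ((29))] -/
theorem PsiSteps.exists_walk_eq {ψ : V → Site 2} {L₀ : ℕ} (hps : PsiSteps G ψ L₀) (w : V) (y : Site 2) :
    ∃ w' : V, ψ w' = y ∧ ∃ p : G.Walk w w', p.length ≤ L₀ * l1 y (ψ w) ∧ ∀ u ∈ p.support, InHull (ψ w) y (ψ u) := by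
  suffices hmain : ∀ (d : ℕ) (w : V) (y : Site 2), l1 y (ψ w) = d →
      ∃ w' : V, ψ w' = y ∧ ∃ p : G.Walk w w', p.length ≤ L₀ * d ∧ ∀ u ∈ p.support, InHull (ψ w) y (ψ u) from hmain _ w y rfl
  intro d
  induction d with
  | zero =>
    intro w y hy
    have h0 : (y 0 - ψ w 0).natAbs = 0 := by unfold l1 at hy; omega
    have h1 : (y 1 - ψ w 1).natAbs = 0 := by unfold l1 at hy; omega
    have hyw : ψ w = y := by
      funext j; fin_cases j
      · exact (sub_eq_zero.1 (Int.natAbs_eq_zero.1 h0)).symm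
      · exact (sub_eq_zero.1 (Int.natAbs_eq_zero.1 h1)).symm
    refine ⟨w, hyw, SimpleGraph.Walk.nil, by simp, fun u hu => ?_⟩
    rw [SimpleGraph.Walk.support_nil, List.mem_singleton] at hu
    rw [hu, ← hyw]; exact inHull_left _ _
  | succ d ih =>
    intro w y hy
    -- a coordinate `i` with `y i ≠ ψ w i`; one weak step towards `y` in that coordinate
    have hex : ∃ i : Fin 2, y i ≠ ψ w i := by
      by_contra hcon
      push Not at hcon
      have := hcon 0; have := hcon 1
      unfold l1 at hy; simp_all
    obtain ⟨i, hi⟩ := hex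
    set σ : ℤˣ := if ψ w i < y i then 1 else -1 with hσdef
    have hσv : (σ : ℤ) = if ψ w i < y i then 1 else -1 := by rw [hσdef]; split_ifs <;> rfl
    obtain ⟨w₁, hw₁, p₁, hp₁, htr₁⟩ := hps w i σ
    -- the intermediate point is one unit closer to `y` in coordinate `i` and unchanged in the other
    have hstep_i : ψ w₁ i = ψ w i + (σ : ℤ) := by rw [hw₁]; simp
    have hstep_j : ∀ j, j ≠ i → ψ w₁ j = ψ w j := by intro j hj; rw [hw₁]; simp [hj]
    have hd : l1 y (ψ w₁) = d := by
      have key : (y i - ψ w₁ i).natAbs + 1 = (y i - ψ w i).natAbs := by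
        rw [hstep_i, hσv]
        by_cases hlt : ψ w i < y i
        · rw [if_pos hlt]; omega
        · rw [if_neg hlt]; have hgt : y i < ψ w i := lt_of_le_of_ne (not_lt.1 hlt) hi; omega
      unfold l1 at hy ⊢
      fin_cases i
      · have e1 := hstep_j 1 (by decide); simp only [Fin.zero_eta] at key; rw [e1]; omega
      · have e0 := hstep_j 0 (by decide); simp only [Fin.mk_one] at key; rw [e0]; omega
    obtain ⟨w', hw', p₂, hp₂, htr₂⟩ := ih w₁ y hd
    refine ⟨w', hw', p₁.append p₂, ?_, fun u hu => ?_⟩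
    · rw [SimpleGraph.Walk.length_append]
      have : L₀ * (d + 1) = L₀ + L₀ * d := by ring
      rw [this]; exact Nat.add_le_add hp₁ hp₂
    · -- the intermediate point lies in the hull box of `ψ w`, `y` (unwidened), so both partial tracks lie in the widened hull
      have hmid : ∀ j, min (ψ w j) (y j) ≤ ψ w₁ j ∧ ψ w₁ j ≤ max (ψ w j) (y j) := by
        intro j
        by_cases hj : j = i
        · subst hj
          rw [hstep_i, hσv]
          by_cases hlt : ψ w j < y j
          · rw [if_pos hlt]; constructor
            · exact (min_le_left _ _).trans (by linarith)
            · exact le_trans (by linarith) (le_max_right _ _)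
          · rw [if_neg hlt]; have hgt : y j < ψ w j := lt_of_le_of_ne (not_lt.1 hlt) hi; constructor
            · exact (min_le_right _ _).trans (by linarith)
            · exact le_trans (by linarith) (le_max_left _ _)
        · rw [hstep_j j hj]; exact ⟨min_le_left _ _, le_max_left _ _⟩
      rw [SimpleGraph.Walk.mem_support_append_iff] at hu
      rcases hu with hu | hu
      · exact (htr₁ u hu).mono (fun j => ⟨min_le_left _ _, le_max_left _ _⟩) hmid
      · exact (htr₂ u hu).mono hmid (fun j => ⟨min_le_right _ _, le_max_right _ _⟩)

/-- **Reaching a planar target inside a graph ball** of radius `L₀·‖y − ψ w‖₁`. [folklore] -/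
theorem PsiSteps.exists_mem_graphBall_eq {ψ : V → Site 2} {L₀ : ℕ} (hps : PsiSteps G ψ L₀) (w : V) (y : Site 2) :
    ∃ w' : V, w' ∈ graphBall G w (L₀ * l1 y (ψ w)) ∧ ψ w' = y := by
  obtain ⟨w', hw', p, hp, -⟩ := hps.exists_walk_eq w y
  exact ⟨w', ⟨p, hp⟩, hw'⟩

end Skelφ

end Summit.CriticalPhenomena.PercolationContinuityZ3.Theorems.Transplant

end
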